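import Summits.NavierStokesRegularity.FunctionalMining.StrainFlat
import Summits.NavierStokesRegularity.FunctionalMining.StrainViscous
import Summits.NavierStokesRegularity.FunctionalMining.StrainL4Pointwise
import HarnessLib

/-!
# FunctionalMining — the flattened strain tensor along a classical solution: `∂ₜS` as a vector

Search for candidate a priori estimates; no regularity claim. Cell `pub-nsfunc`, prove seat
(gen 16). For a balance law with a weight `W(S)` of the FULL strain tensor (not only of `|S|²`),
the strain equation is needed componentwise, as an identity between vectors of
`EuclideanSpace ℝ (d × d)` (the carrier of `StrainL4.strainFlat`). Along a classical solution of
`∂ₜu + (u·∇)u = νΔu − ∇p + f`, `div u = 0` on `T^d × [a, b]` (Majda–Bertozzi (1.29) symmetrised):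

`∂ₜS = ν ΔS − Π + S_f − N − (u·∇)S`,

`Πᵢⱼ = ∂ᵢ∂ⱼp` (`pressVec`), `(S_f)ᵢⱼ = ((∂ⱼf)ᵢ + (∂ᵢf)ⱼ)/2` (`strainFlat f`),
`Nᵢⱼ = ½∑ₖ((∂ⱼu)ₖ(∂ₖu)ᵢ + (∂ᵢu)ₖ(∂ₖu)ⱼ)` (`nonlinVec`), `((u·∇)S) = ∑ₖ uₖ ∂ₖS`.

## Main statements

* `StrainTensor.isSmoothSpaceTimeOn_strainFlat` — joint smoothness of `(s, y) ↦ S(u s)(y)`.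
* `StrainTensor.laplacian_strainFlat_apply` — `(ΔS)ᵢⱼ = ((∂ⱼΔu)ᵢ + (∂ᵢΔu)ⱼ)/2`.
* `StrainTensor.timeDerivWithin_strainFlat_eq` — the vector identity above.
* `StrainTensor.norm_pressVec_le`, `StrainTensor.norm_nonlinVec_le` — `‖Π‖ ≤ ∑ᵢⱼ|∂ᵢ∂ⱼp|`,
  `‖N‖ ≤ ∑ₖ‖∂ₖu‖²`.
[ours; folklore calculus — Majda–Bertozzi 2002 §1.4 (1.29), via the tree's
`GradientTensor.timeDerivWithin_partialDeriv_apply`]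
-/

noncomputable section

open MeasureTheory Set Finset
open scoped InnerProductSpace RealInnerProductSpace ContDiff

namespace Summit.NavierStokesRegularity.FunctionalMining

open Literature.Analysis.FunctionSpaces Literature.Analysis.FluidPDE StrainL4

namespace StrainTensor

variable {d : Type*} [Fintype d] [DecidableEq d]

/-! ## 1. Joint smoothness and coordinates of the time derivative -/

/-- `(s, y) ↦ strainFlat (u s) y` is jointly smooth along a jointly smooth velocity. [ours] -/
theorem isSmoothSpaceTimeOn_strainFlat {S : Set ℝ} {u : ℝ → UnitAddTorus d → EuclideanSpace ℝ d}
    (hu : Torus.IsSmoothSpaceTimeOn S u) (hS : UniqueDiffOn ℝ S) :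
    Torus.IsSmoothSpaceTimeOn S (fun s y => strainFlat (u s) y) := by
  unfold Torus.IsSmoothSpaceTimeOn
  rw [contDiffOn_euclidean]
  intro p
  exact GradientTensor.isSmoothSpaceTimeOn_strainEntry hu hS p.1 p.2

omit [DecidableEq d] in
/-- Coordinates commute with the one-sided time derivative (any Euclidean codomain). [folklore] -/
theorem timeDerivWithin_apply_coord {ι : Type*} [Fintype ι] {S : Set ℝ}
    {φ : ℝ → UnitAddTorus d → EuclideanSpace ℝ ι} (hφ : Torus.IsSmoothSpaceTimeOn S φ)
    (hS : UniqueDiffOn ℝ S) {t : ℝ} (ht : t ∈ S) (x : UnitAddTorus d) (p : ι) :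
    Torus.timeDerivWithin S (fun s y => φ s y p) t x = Torus.timeDerivWithin S φ t x p := by
  have h := hφ.hasDerivWithinAt_slice ht x
  have h2 : HasDerivWithinAt (fun τ => φ τ x p) (Torus.timeDerivWithin S φ t x p) S t :=
    (EuclideanSpace.proj p : EuclideanSpace ℝ ι →L[ℝ] ℝ).hasFDerivAt.comp_hasDerivWithinAt t h
  exact h2.derivWithin (hS t ht)

/-! ## 2. The Laplacian of the flattened strain -/

/-- `(∂ₖ∂ₖS)ᵢⱼ = (∂ₖ(∂ₖ∂ⱼv)ᵢ + ∂ₖ(∂ₖ∂ᵢv)ⱼ)/2`. [folklore] -/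
theorem partialDeriv_partialDeriv_strainFlat_apply {v : UnitAddTorus d → EuclideanSpace ℝ d}
    (hv : Torus.IsSmooth v) (k i j : d) (y : UnitAddTorus d) :
    Torus.partialDeriv k (Torus.partialDeriv k (strainFlat v)) y (i, j) =
      (Torus.partialDeriv k (fun z => Torus.partialDeriv k (Torus.partialDeriv j v) z i) y +
        Torus.partialDeriv k (fun z => Torus.partialDeriv k (Torus.partialDeriv i v) z j) y) / 2 := by
  have hS : Torus.IsSmooth (strainFlat v) := isSmooth_strainFlat hv
  have h1 : Torus.partialDeriv k (Torus.partialDeriv k (strainFlat v)) y (i, j) =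
      Torus.partialDeriv k (fun z => Torus.partialDeriv k (strainFlat v) z (i, j)) y :=
    (EuclideanCoord.partialDeriv_apply_coord ((hS.partialDeriv k).isContDiff (by simp)) k y (i, j)).symm
  have h2 : (fun z => Torus.partialDeriv k (strainFlat v) z (i, j)) = fun z =>
      (Torus.partialDeriv k (Torus.partialDeriv j v) z i + Torus.partialDeriv k (Torus.partialDeriv i v) z j) / 2 := by
    funext z
    rw [← EuclideanCoord.partialDeriv_apply_coord (hS.isContDiff (by simp)) k z (i, j)]
    simp only [strainFlat_apply]
    exact GradientTensor.partialDeriv_strainEntry hv i j k z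
  have hji : Torus.IsContDiff 1 (fun z => Torus.partialDeriv k (Torus.partialDeriv j v) z i) :=
    (((hv.partialDeriv j).partialDeriv k).apply i).isContDiff (by simp)
  have hij : Torus.IsContDiff 1 (fun z => Torus.partialDeriv k (Torus.partialDeriv i v) z j) :=
    (((hv.partialDeriv i).partialDeriv k).apply j).isContDiff (by simp)
  have hfun : (fun z => (Torus.partialDeriv k (Torus.partialDeriv j v) z i + Torus.partialDeriv k (Torus.partialDeriv i v) z j) / 2) =
      (2⁻¹ : ℝ) • ((fun z => Torus.partialDeriv k (Torus.partialDeriv j v) z i) +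
        fun z => Torus.partialDeriv k (Torus.partialDeriv i v) z j) := by
    funext z; simp only [Pi.smul_apply, Pi.add_apply, smul_eq_mul]; ring
  rw [h1, h2, hfun, Torus.partialDeriv_const_smul (hji.add hij) _ k, Pi.smul_apply,
    Torus.partialDeriv_add hji hij k, Pi.add_apply, smul_eq_mul]
  ring

/-- **`(ΔS)ᵢⱼ = ((∂ⱼΔv)ᵢ + (∂ᵢΔv)ⱼ)/2`** for smooth `v`. [folklore] -/
theorem laplacian_strainFlat_apply {v : UnitAddTorus d → EuclideanSpace ℝ d} (hv : Torus.IsSmooth v)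
    (i j : d) (y : UnitAddTorus d) :
    Torus.laplacian (strainFlat v) y (i, j) =
      (Torus.partialDeriv j (Torus.laplacian v) y i + Torus.partialDeriv i (Torus.laplacian v) y j) / 2 := by
  rw [Torus.laplacian_eq_sum_partialDeriv_partialDeriv (isSmooth_strainFlat hv) y,
    WithLp.ofLp_sum, Finset.sum_apply]
  simp_rw [partialDeriv_partialDeriv_strainFlat_apply hv _ i j y]
  rw [GradientTensor.partialDeriv_laplacian_apply_eq_sum hv j i y,
    GradientTensor.partialDeriv_laplacian_apply_eq_sum hv i j y, ← Finset.sum_div,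
    Finset.sum_add_distrib]

/-! ## 3. The production vectors and the strain equation as a vector identity -/

/-- The pressure-Hessian tensor `Πᵢⱼ = ∂ᵢ∂ⱼP` as a vector of `ℝ^{d×d}`. [ours, bookkeeping] -/
def pressVec (P : UnitAddTorus d → ℝ) (y : UnitAddTorus d) : EuclideanSpace ℝ (d × d) :=
  WithLp.toLp 2 fun q => Torus.partialDeriv q.1 (Torus.partialDeriv q.2 P) y

/-- The symmetrised quadratic production `Nᵢⱼ = ½∑ₖ((∂ⱼv)ₖ(∂ₖv)ᵢ + (∂ᵢv)ₖ(∂ₖv)ⱼ)`. [ours, bookkeeping] -/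
def nonlinVec (v : UnitAddTorus d → EuclideanSpace ℝ d) (y : UnitAddTorus d) :
    EuclideanSpace ℝ (d × d) :=
  WithLp.toLp 2 fun q => ((∑ k, Torus.partialDeriv q.2 v y k * Torus.partialDeriv k v y q.1) +
    ∑ k, Torus.partialDeriv q.1 v y k * Torus.partialDeriv k v y q.2) / 2

omit [Fintype d] in
/-- Entries of `pressVec`. [ours] -/
@[simp] theorem pressVec_apply (P : UnitAddTorus d → ℝ) (y : UnitAddTorus d) (q : d × d) :
    pressVec P y q = Torus.partialDeriv q.1 (Torus.partialDeriv q.2 P) y := rfl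

/-- Entries of `nonlinVec`. [ours] -/
@[simp] theorem nonlinVec_apply (v : UnitAddTorus d → EuclideanSpace ℝ d) (y : UnitAddTorus d)
    (q : d × d) :
    nonlinVec v y q = ((∑ k, Torus.partialDeriv q.2 v y k * Torus.partialDeriv k v y q.1) +
      ∑ k, Torus.partialDeriv q.1 v y k * Torus.partialDeriv k v y q.2) / 2 := rfl

/-- **The strain equation, componentwise vector form.** Along a classical solution of
`∂ₜu + (u·∇)u = νΔu − ∇p + f`, `div u = 0` on `T^d × [a, b]`:
`∂ₜS = νΔS − Π + S_f − N − ∑ₖ uₖ ∂ₖS` at every `t ∈ [a, b]`, `y ∈ T^d`.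
[cite: MajdaBertozziCUP2002, §1.4 eq. (1.29), symmetrised; ours for the packaging] -/
theorem timeDerivWithin_strainFlat_eq
    {a b ν : ℝ} {f u : ℝ → UnitAddTorus d → EuclideanSpace ℝ d} {p : ℝ → UnitAddTorus d → ℝ}
    (h : Torus.IsClassicalNSSolutionOn (Icc a b) ν f u p) (hab : a < b) {t : ℝ} (ht : t ∈ Icc a b)
    (y : UnitAddTorus d) :
    Torus.timeDerivWithin (Icc a b) (fun s z => strainFlat (u s) z) t y =
      ν • Torus.laplacian (strainFlat (u t)) y - pressVec (p t) y + strainFlat (f t) y -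
        nonlinVec (u t) y - ∑ k, u t y k • Torus.partialDeriv k (strainFlat (u t)) y := by
  have hU : UniqueDiffOn ℝ (Icc a b) := uniqueDiffOn_Icc hab
  have hu : Torus.IsSmoothSpaceTimeOn (Icc a b) u := h.smooth_velocity
  have hut : Torus.IsSmooth (u t) := hu.isSmooth_slice ht
  have hpt : Torus.IsSmooth (p t) := h.smooth_pressure.isSmooth_slice ht
  have hΘ := isSmoothSpaceTimeOn_strainFlat hu hU
  have hSt : Torus.IsSmooth (strainFlat (u t)) := isSmooth_strainFlat hut
  ext ⟨i, j⟩
  rw [← timeDerivWithin_apply_coord hΘ hU ht y (i, j)]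
  -- the scalar entry `s ↦ S_{ij}(u s)(y)` and its time derivative
  have hDij := GradientTensor.hasDerivWithinAt_partialDeriv_apply h hab ht i j y
  have hDji := GradientTensor.hasDerivWithinAt_partialDeriv_apply h hab ht j i y
  have hE : HasDerivWithinAt (fun s => strainFlat (u s) y (i, j))
      ((Torus.partialDeriv j (Torus.timeDerivWithin (Icc a b) u t) y i +
        Torus.partialDeriv i (Torus.timeDerivWithin (Icc a b) u t) y j) / 2) (Icc a b) t := by
    have h1 := (hDji.add hDij).div_const 2
    exact h1
  have hTij := GradientTensor.timeDerivWithin_partialDeriv_apply h hab ht i j y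
  have hTji := GradientTensor.timeDerivWithin_partialDeriv_apply h hab ht j i y
  rw [Torus.timeDerivWithin, hDij.derivWithin (hU t ht)] at hTij
  rw [Torus.timeDerivWithin, hDji.derivWithin (hU t ht)] at hTji
  rw [show Torus.timeDerivWithin (Icc a b) (fun s z => strainFlat (u s) z (i, j)) t y =
      derivWithin (fun s => strainFlat (u s) y (i, j)) (Icc a b) t from rfl,
    hE.derivWithin (hU t ht), hTij, hTji]
  -- the right-hand side, entry `(i, j)`
  have hsum : (∑ k, u t y k • Torus.partialDeriv k (strainFlat (u t)) y) (i, j) =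
      ∑ k, u t y k * ((Torus.partialDeriv k (Torus.partialDeriv j (u t)) y i +
        Torus.partialDeriv k (Torus.partialDeriv i (u t)) y j) / 2) := by
    rw [WithLp.ofLp_sum, Finset.sum_apply]
    refine Finset.sum_congr rfl fun k _ => ?_
    rw [WithLp.ofLp_smul, Pi.smul_apply, smul_eq_mul,
      ← EuclideanCoord.partialDeriv_apply_coord (hSt.isContDiff (by simp)) k y (i, j)]
    simp only [strainFlat_apply]
    rw [GradientTensor.partialDeriv_strainEntry hut i j k y]
  have hcomm : Torus.partialDeriv j (Torus.partialDeriv i (p t)) y = Torus.partialDeriv i (Torus.partialDeriv j (p t)) y :=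
    Torus.partialDeriv_comm hpt j i y
  rw [WithLp.ofLp_sub, WithLp.ofLp_sub, WithLp.ofLp_add, WithLp.ofLp_sub, WithLp.ofLp_smul]
  simp only [Pi.sub_apply, Pi.add_apply, Pi.smul_apply, smul_eq_mul]
  rw [hsum, laplacian_strainFlat_apply hut i j y]
  simp only [pressVec_apply, nonlinVec_apply, strainFlat_apply]
  rw [hcomm]
  have e3 : ∑ k, u t y k * ((Torus.partialDeriv k (Torus.partialDeriv j (u t)) y i +
      Torus.partialDeriv k (Torus.partialDeriv i (u t)) y j) / 2) =
      (∑ k, u t y k * Torus.partialDeriv k (Torus.partialDeriv j (u t)) y i +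
        ∑ k, u t y k * Torus.partialDeriv k (Torus.partialDeriv i (u t)) y j) / 2 := by
    rw [← Finset.sum_add_distrib, Finset.sum_div]
    exact Finset.sum_congr rfl fun k _ => by ring
  rw [e3]
  ring

/-! ## 4. Norm bounds for the production vectors -/

omit [DecidableEq d] in
/-- `‖w‖ ≤ ∑_q |w_q|` in `EuclideanSpace ℝ ι`. [folklore] -/
theorem norm_le_sum_abs {ι : Type*} [Fintype ι] (w : EuclideanSpace ℝ ι) : ‖w‖ ≤ ∑ q, |w q| := by
  have h0 : 0 ≤ ∑ q, |w q| := Finset.sum_nonneg fun q _ => abs_nonneg _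
  have hsq : ‖w‖ ^ 2 ≤ (∑ q, |w q|) ^ 2 := by
    rw [EuclideanCoord.norm_sq_eq_sum_sq]
    calc ∑ q, w q ^ 2 = ∑ q, |w q| ^ 2 := Finset.sum_congr rfl fun q _ => (sq_abs _).symm
      _ ≤ (∑ q, |w q|) ^ 2 := Finset.sum_sq_le_sq_sum_of_nonneg fun q _ => abs_nonneg _
  have := abs_le_of_sq_le_sq hsq h0
  rwa [abs_of_nonneg (norm_nonneg _)] at this

/-- **`‖Π‖ ≤ ∑ᵢⱼ |∂ᵢ∂ⱼP|`.** [ours] -/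
theorem norm_pressVec_le (P : UnitAddTorus d → ℝ) (y : UnitAddTorus d) :
    ‖pressVec P y‖ ≤ ∑ i, ∑ j, |Torus.partialDeriv i (Torus.partialDeriv j P) y| := by
  refine (norm_le_sum_abs _).trans (le_of_eq ?_)
  rw [Fintype.sum_prod_type]
  rfl

/-- **`‖N‖ ≤ ∑ₖ ‖∂ₖv‖²`.** [ours] -/
theorem norm_nonlinVec_le (v : UnitAddTorus d → EuclideanSpace ℝ d) (y : UnitAddTorus d) :
    ‖nonlinVec v y‖ ≤ ∑ k, ‖Torus.partialDeriv k v y‖ ^ 2 := by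
  set M : d → d → ℝ := fun i j => ∑ k, Torus.partialDeriv i v y k * Torus.partialDeriv k v y j with hM
  have hg0 : 0 ≤ ∑ k, ‖Torus.partialDeriv k v y‖ ^ 2 := Finset.sum_nonneg fun k _ => sq_nonneg _
  have hMsq : ∑ i, ∑ j, M i j ^ 2 ≤ (∑ k, ‖Torus.partialDeriv k v y‖ ^ 2) ^ 2 := sum_gradgrad_sq_le v y
  have hsq : ‖nonlinVec v y‖ ^ 2 ≤ (∑ k, ‖Torus.partialDeriv k v y‖ ^ 2) ^ 2 := by
    rw [EuclideanCoord.norm_sq_eq_sum_sq, Fintype.sum_prod_type]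
    have hpt : ∀ i j, nonlinVec v y (i, j) ^ 2 ≤ (M j i ^ 2 + M i j ^ 2) / 2 := by
      intro i j
      rw [nonlinVec_apply]
      show ((M j i + M i j) / 2) ^ 2 ≤ (M j i ^ 2 + M i j ^ 2) / 2
      nlinarith [sq_nonneg (M j i - M i j)]
    calc ∑ i, ∑ j, nonlinVec v y (i, j) ^ 2 ≤ ∑ i, ∑ j, (M j i ^ 2 + M i j ^ 2) / 2 :=
          Finset.sum_le_sum fun i _ => Finset.sum_le_sum fun j _ => hpt i j
      _ = ∑ i, ∑ j, M i j ^ 2 := by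
          simp only [add_div, Finset.sum_add_distrib]
          rw [Finset.sum_comm (f := fun i j => M j i ^ 2 / 2), ← Finset.sum_add_distrib]
          refine Finset.sum_congr rfl fun i _ => ?_
          rw [← Finset.sum_add_distrib]
          exact Finset.sum_congr rfl fun j _ => by ring
      _ ≤ (∑ k, ‖Torus.partialDeriv k v y‖ ^ 2) ^ 2 := hMsq
  have := abs_le_of_sq_le_sq hsq hg0
  rwa [abs_of_nonneg (norm_nonneg _)] at this

end StrainTensor

end Summit.NavierStokesRegularity.FunctionalMining

end
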